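import Literature.NumberTheory.EllipticCurves.BSDQuadraticDescentCasselsProofs
import Literature.NumberTheory.EllipticCurves.IsogenyCanonicalHeightProofs
import HarnessLib

/-!
# Cassels' isogeny invariance of the BSD quotient: the height term discharged

Third sibling *proofs* file (theorems only) of
`Literature.NumberTheory.EllipticCurves.BSDQuadraticDescent` for the named fact
`WeierstrassCurve.bsdRHS_eq_of_isIsogenous` (Cassels 1965; Milne, *ADT*, Thm. I.7.3). The sibling
`BSDQuadraticDescentCasselsProofs` reduced the equality of the Birch–Swinnerton-Dyer quotients
of a `ℚ`-isogenous pair to three per-pair inputs: (H) adjointness of `φ(ℚ)`, `φ̂(ℚ)` for the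
Néron–Tate pairings, (Ш) the Cassels–Tate relation `#Ш(E) · #ker Ш(φ̂) = #Ш(E') · #ker Ш(φ)`,
and Milne's formula (7.3.1) with its local side evaluated. The input (H) is now a theorem of the
tree — `WeierstrassCurve.Isogeny.heightPairing_pointHom_left` (`IsogenyCanonicalHeightProofs`,
from `ĥ_{E'}(φ P) = deg φ · ĥ_E(P)`) — and this file records the resulting reductions with (H)
discharged:

* `WeierstrassCurve.Isogeny.card_sha_mul_regulator_mul_eq_of_sha_of_keyIdentity` (number field);
* `WeierstrassCurve.bsdRHS_eq_of_sha_of_keyIdentity` (over `ℚ`: `W'.bsdRHS = W.bsdRHS` from (Ш),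
  (7.3.1) and the finiteness of `Ш(E/ℚ)`).

What still separates these from `bsdRHS_eq_of_isIsogenous_holds`: the Cassels–Tate pairing with
its non-degeneracy and isogeny-adjointness (*ADT* I.6.13(a), proof of 7.3 p. 98), and (7.3.1)
itself (Tate local duality, Poitou–Tate I.4.10, Euler characteristic I.5.2a, pp. 99–100) together
with the local volume computation `∏_{v ∈ S} z(φ(ℚ_v)) = Ω(E)∏c_p(E)/(Ω(E')∏c_p(E'))` — none of
which is in Mathlib or the tree.

## References

* [MilneADT2006] J. S. Milne, *Arithmetic Duality Theorems*, 2nd ed. (2006), Ch. I §7, Thm. 7.3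
  and its proof, (7.3.1), pp. 97–100.
* [Cassels1965ArithmeticVIII] J. W. S. Cassels, J. reine angew. Math. 217 (1965), 180–199.

## Design

Theorems only; the dual isogeny is normalised as in `Isogeny.exists_dual_of_isElliptic`
(`ψ ∘ φ = [deg φ]`); the `ℚ` statement is polymorphic in the `DecidableEq ℚ` instance, bridged to
the classical one inside the proof as in `BSDQuadraticDescentCasselsProofs`.
-/

noncomputable section

open scoped Classical

universe u
/-! ## Cassels' theorem modulo (Ш) and (7.3.1): hypothesis (H) discharged -/

namespace WeierstrassCurve

namespace Isogeny

open Literature.NumberTheory.EllipticCurves Affine.Point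

variable {K : Type u} [Field K] [NumberField K] {W W' : WeierstrassCurve K}
  [W.IsElliptic] [W'.IsElliptic]

/-- **Milne's Theorem I.7.3 for elliptic curves over a number field, reduced to (Ш) and (7.3.1)**:
`WeierstrassCurve.Isogeny.card_sha_mul_regulator_mul_eq_of_keyIdentity` with its hypothesis (H)
— the adjointness of `φ(K)` and `φ̂(K)` for the Néron–Tate pairings — discharged by
`Isogeny.heightPairing_pointHom_left` (`IsogenyCanonicalHeightProofs`), for the dual isogeny
`ψ = φ̂` normalised by `ψ ∘ φ = [deg φ]` (`Isogeny.exists_dual_of_isElliptic`). What remains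
assumed is (Ш) `#Ш(E) · #ker Ш(ψ) = #Ш(E') · #ker Ш(φ)` (Cassels–Tate, *ADT* I.6.13(a) and p. 98)
and (7.3.1) (*ADT* p. 98, proved there from Tate local duality, Poitou–Tate I.4.10 and the Euler
characteristic formula I.5.2a, pp. 99–100).
[cite: MilneADT2006, Ch. I, Thm. 7.3 and its proof, (7.3.1), pp. 97–100] -/
theorem card_sha_mul_regulator_mul_eq_of_sha_of_keyIdentity (φ : Isogeny W W') (ψ : Isogeny W' W)
    (hψφ : ∀ P : W.geomPoints, ψ (φ P) = (φ.degree : ℤ) • P)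
    (f : W.toAffine.Point →+ W'.toAffine.Point)
    (hf : ∀ P, W'.toGeomPoints (f P) = φ (W.toGeomPoints P))
    (g : W'.toAffine.Point →+ W.toAffine.Point)
    (hg : ∀ Q, W.toGeomPoints (g Q) = ψ (W'.toGeomPoints Q))
    (hSha : Nat.card W.sha *
        Nat.card (shaMap ψ.toAddMonoidHom ψ.equivariant ψ.hasLocalPointsMaps_toAddMonoidHom).ker =
      Nat.card W'.sha *
        Nat.card (shaMap φ.toAddMonoidHom φ.equivariant φ.hasLocalPointsMaps_toAddMonoidHom).ker)
    (x x' : ℝ)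
    (h731 : x *
        Nat.card (shaMap φ.toAddMonoidHom φ.equivariant φ.hasLocalPointsMaps_toAddMonoidHom).ker *
          Nat.card g.ker * f.range.index =
      x' *
        Nat.card (shaMap ψ.toAddMonoidHom ψ.equivariant ψ.hasLocalPointsMaps_toAddMonoidHom).ker *
          Nat.card f.ker * g.range.index)
    (hfin : W.ShaFinite) :
    (Nat.card W'.sha : ℝ) * W'.regulator * x' *
        (Nat.card (AddCommGroup.torsion W.toAffine.Point) : ℝ) ^ 2 =
      (Nat.card W.sha : ℝ) * W.regulator * x *
        (Nat.card (AddCommGroup.torsion W'.toAffine.Point) : ℝ) ^ 2 :=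
  card_sha_mul_regulator_mul_eq_of_keyIdentity φ ψ φ.degree_pos.ne' hψφ f hf g hg
    (heightPairing_pointHom_left φ ψ hψφ hf hg) hSha x x' h731 hfin

end Isogeny

section Rat

open Literature.NumberTheory.EllipticCurves Affine.Point

variable {W W' : WeierstrassCurve ℚ}

/-- **Cassels' theorem over `ℚ` (`WeierstrassCurve.bsdRHS_eq_of_isIsogenous`) reduced to the
Cassels–Tate step (Ш) and Milne's formula (7.3.1) with its local side evaluated**:
`WeierstrassCurve.bsdRHS_eq_of_keyIdentity` with hypothesis (H) discharged by the functoriality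
of the canonical height (`Isogeny.heightPairing_pointHom_left`), for `ψ = φ̂` with
`ψ ∘ φ = [deg φ]`. If `#Ш(E) · #ker Ш(ψ) = #Ш(E') · #ker Ш(φ)` and
`Ω(E) ∏c_p(E) · #ker Ш(φ) · #ker ψ(ℚ) · [E'(ℚ) : φ(E(ℚ))] =
Ω(E') ∏c_p(E') · #ker Ш(ψ) · #ker φ(ℚ) · [E(ℚ) : ψ(E'(ℚ))]` (formula (7.3.1) for the pair, *ADT*
p. 98, with `∏_{v∈S} z(φ(ℚ_v)) = Ω(E)∏c_p(E)/(Ω(E')∏c_p(E'))` for globally minimal models), and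
`Ш(E/ℚ)` is finite, then `E` and `E'` have the same Birch–Swinnerton-Dyer quotient
`WeierstrassCurve.bsdRHS`. Polymorphic in the `DecidableEq ℚ` instance of the group law.
[cite: MilneADT2006, Ch. I, Thm. 7.3 and its proof, (7.3.1), pp. 97–100] -/
theorem bsdRHS_eq_of_sha_of_keyIdentity [DecidableEq ℚ] [W.IsElliptic] [W'.IsElliptic]
    (φ : Isogeny W W') (ψ : Isogeny W' W)
    (hψφ : ∀ P : W.geomPoints, ψ (φ P) = (φ.degree : ℤ) • P)
    (f : W.toAffine.Point →+ W'.toAffine.Point)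
    (hf : ∀ P, W'.toGeomPoints (f P) = φ (W.toGeomPoints P))
    (g : W'.toAffine.Point →+ W.toAffine.Point)
    (hg : ∀ Q, W.toGeomPoints (g Q) = ψ (W'.toGeomPoints Q))
    (hSha : Nat.card W.sha *
        Nat.card (shaMap ψ.toAddMonoidHom ψ.equivariant ψ.hasLocalPointsMaps_toAddMonoidHom).ker =
      Nat.card W'.sha *
        Nat.card (shaMap φ.toAddMonoidHom φ.equivariant φ.hasLocalPointsMaps_toAddMonoidHom).ker)
    (h731 : W.realPeriodRat * W.tamagawaProduct *
        Nat.card (shaMap φ.toAddMonoidHom φ.equivariant φ.hasLocalPointsMaps_toAddMonoidHom).ker *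
          Nat.card g.ker * f.range.index =
      W'.realPeriodRat * W'.tamagawaProduct *
        Nat.card (shaMap ψ.toAddMonoidHom ψ.equivariant ψ.hasLocalPointsMaps_toAddMonoidHom).ker *
          Nat.card f.ker * g.range.index)
    (hfin : W.ShaFinite) : W'.bsdRHS = W.bsdRHS := by
  -- bridge the `DecidableEq ℚ` instance to the classical one of the general theorems
  obtain rfl : ‹DecidableEq ℚ› = fun a b ↦ Classical.propDecidable (a = b) :=
    Subsingleton.elim _ _
  exact @bsdRHS_eq_of_keyIdentity W W' (fun a b ↦ Classical.propDecidable (a = b)) _ _ φ ψ _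
    φ.degree_pos.ne' hψφ f hf g hg (Isogeny.heightPairing_pointHom_left φ ψ hψφ hf hg) hSha h731
    hfin

end Rat

end WeierstrassCurve

end
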